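import Literature.MathematicalPhysics.QuantumLattice.ClusterProductStateEnergy
import Literature.MathematicalPhysics.QuantumLattice.FermionBlockProductStateEntropy
import Literature.MathematicalPhysics.QuantumLattice.FermionLocalHamiltonianCovariance
import Literature.MathematicalPhysics.QuantumLattice.PeriodicPressureSuperlatticeIndependence
import HarnessLib

/-!
# The EXACT cluster-Gibbs FLOOR on the periodic variational pressure from ONE open aligned rectangle:
# `log Re Tr e^{−βH_{[0,Q+1)}} + β Re Ψ∅ ≤ |[0,Q+1)| · P_q(β,Ψ)` for superlattice-periodic models whose straddling terms vanish in
# block product states (every hopping-type model: one-band `t–t′–t″`, decorated / three-band `CuO₂`, staggered, strained, layered cells)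

Topic `Literature/MathematicalPhysics/QuantumLattice` (family `hubbard`, model-free, general `d ≥ 1`). Written for stage S2 (CERTIFIER-FAMILIES,
«families of models … multi-band, T > 0») of the Hubbard material-oracle programme (crew hubbard-fast, seat hubbard-box-p1). The T > 0 two-sided
CLUSTER WINDOW on the pressure of a `q`-periodic lattice-fermion model has a CAP half — the weighted open cluster
(`WeightedOpenClusterBoundsPeriodic.perVarPressure_le_log_partitionFn_reweight`, boosted couplings) — and a FLOOR half, the Gibbs state of an
open cluster used as a periodic product trial state in the variational principle. The tree had the floor only with a COLLAR error
(`PeriodicGibbsVariationalPrinciple.le_perVarPressure_of_box`, cubes, `|β|·col_R(N)·S_q/N^d`) and, for the one-band `t–t′` model alone, the exact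
form via torus tilings (`HubbardTTPrimeOpenBoxGrandCanonicalPressureExact`). Here is the EXACT floor for every periodic model whose terms
straddling a block boundary have zero expectation in block product states (odd × odd factors: every model whose only inter-site terms are
hoppings), from an arbitrary aligned RECTANGLE (`a × b` cells, not only cubes):

* §1 **THE ENTROPY DENSITY OF THE RECTANGULAR TILING STATE IS EXACTLY `S(ρ₀)/|[0,Q+1)|`** (`entropyDensitySup_rectTilingState`; `ρ₀` even and
  faithful): an aligned cube `[0,N)^d` (`(Q_i+1) ∣ N`) is a disjoint union of `N^d/Π(Q_i+1)` full blocks of the tiling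
  (`rectPartition_block_subset_halfOpenBox`, `card_blockClasses_mul_prod_eq_pow`), so `S(⊗ρ₀|_{[0,N)^d}) · Π(Q_i+1) = N^d · S(ρ₀)`
  (`vonNeumannEntropy_rdm_rectTilingState_mul_prod`) by the block-product entropy formula, and the aligned-box limit of `PeriodicStatesMeanEntropy`
  identifies `s̄`.
* §2 **THE EXACT TRIAL VALUE AND THE FLOOR**: with vanishing straddles the `Q`-cell energy density of `⊗ρ₀` is
  `|[0,Q+1)|⁻¹ · Re(tr(H_{[0,Q+1)} ρ₀) − Ψ∅)` (`cellMeanEnergy_rectTilingState_eq`), hence for `Ψ` Hermitian, even, `q`-periodic of finite range with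
  `(q_i+1) ∣ (Q_i+1)` and every real `β`: **`S(ρ₀) − β Re tr(H_{[0,Q+1)} ρ₀) + β Re Ψ∅ ≤ |[0,Q+1)| · P_q(β,Ψ,R)`**
  (`vonNeumannEntropy_sub_mul_le_card_mul_perVarPressure`; the superlattice independence `P_Q = P_q` of `PeriodicPressureSuperlatticeIndependence`
  moves the `Q`-periodic trial state into the `q`-periodic principle), and at the block Gibbs state
  **`log Re Tr e^{−βH_{[0,Q+1)}} + β Re Ψ∅ ≤ |[0,Q+1)| · P_q(β,Ψ,R)`** (`log_partitionFn_rect_le_card_mul_perVarPressure`, `/|[0,Q+1)|` form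
  `log_partitionFn_rect_div_le_perVarPressure`) — NO collar term.
* §3 **SUB-CLUSTER FORM** (`log_partitionFn_sub_le_card_mul_perVarPressure`): if the block Hamiltonian is the embedding of a Hamiltonian `H_S` on a
  sub-region `S ⊆ [0,Q+1)` (decorated lattices: the dummy sites carry no term), the floor reads
  `log Re Tr_S e^{−βH_S} + 2(|[0,Q+1)| − |S|) log 2 + β Re Ψ∅ ≤ |[0,Q+1)| · P_q` — the device computes the PHYSICAL cluster only.

Everything is PROVED (0 sorry); no definition, no named fact, no number. HONEST SCOPE: a trial-state floor; its distance to `P_q` is the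
finite-size error of the open cluster (O(surface/volume)), not estimated here; the matching cap is `perVarPressure_le_log_partitionFn_reweight`.

## Tree / Mathlib search

REUSED: `rectTilingState(_def/_isPeriodic)`, `rectPartition(_block)`, `rectCopy`, `halfOpenRect`, `card_halfOpenRect`, `mem_shiftSet_superlatVec_halfOpenRect`
(`FermionRectTilingProductState`, hubbard-box-p3); `sum_cell_siteEnergy_rectTilingState_eq`, `sum_cell_eq_sum_halfOpenRect` (`ClusterProductStateEnergy`);
`vonNeumannEntropy_rdm_blockProductState_of_forall_subset`, `BlockPartition.sum_card_blockLoc`, `blockLoc_eq_block_of_subset`, `blockClasses`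
(`FermionBlockProductState(Entropy)`); `vonNeumannEntropy_fermionPartialTrace_equiv` (`FermionPartialTrace`); `IsPeriodic.tendsto_boxEntropyDensity_mul`
(`PeriodicStatesMeanEntropy`); `sub_mul_le_perVarPressure`, `cellMeanEnergy` (`PeriodicVariationalPressure`, `PeriodicInteractionsCellEnergy`);
`perVarPressure_eq_of_dvd` (`PeriodicPressureSuperlatticeIndependence`); `IsHermitian.vonNeumannEntropy_gibbsDensity`, `trace_gibbsDensity(_mul)`,
`posDef_gibbsWeight`, `parityAut_gibbsWeight`, `partitionFn_pos` (`GibbsVariationalPrinciple`, `LayeredSystemPartitionFunction`);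
`log_partitionFn_fermionEmbed`, `card_orb_polySite` (`FermionLocalHamiltonianCovariance`); `expect_empty_eq`.
`lean search 'entropyDensitySup.*rectTiling|rectTiling.*perVarPressure|log_partitionFn.*le_perVarPressure'` (2026-08-28): nothing — only the collar form
`le_perVarPressure_of_le_log_partitionFn` and the cubic trial-state entropy FLOOR `le_entropyDensitySup_perTrialState`.

## References

* O. Bratteli, D. W. Robinson, *Operator Algebras and Quantum Statistical Mechanics 2* (1997), Prop. 6.2.38 / Thm. 6.2.40 (periodic product
  trial states in the Gibbs variational principle). [cite: BratteliRobinsonII1997, Thm. 6.2.40]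
* R. B. Israel, *Convexity in the Theory of Lattice Gases* (1979), Lemma II.3.1, Thm. I.2.4. [cite: Israel1979, Lemma II.3.1]
* H. Araki, H. Moriya, Rev. Math. Phys. 15 (2003) 93, Theorem 3.8, §10, §11.1 Thm. 11.2. [cite: ArakiMoriya2003, Theorem 3.8 and §10]
* D. Ruelle, *Statistical Mechanics: Rigorous Results* (1969), §3.3 (cluster trial states). [cite: Ruelle1969, §3.3]
-/

noncomputable section

namespace Literature.MathematicalPhysics.QuantumLattice

open Matrix Finset HubbardWave0 Literature.Probability.LatticeModels ThermodynamicLimit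
open scoped ComplexOrder BigOperators
open Literature.InformationTheory.Entropy (vonNeumannEntropy vonNeumannEntropy_nonneg)
open _root_.Filter
open scoped _root_.Topology

variable {d : ℕ}

/-! ### §1. The entropy density of the rectangular tiling state -/

/-- The transported block state has the entropy of `ρ₀`. [cite: ArakiMoriya2003, §3.1 and §10] -/
theorem vonNeumannEntropy_rectCopy (Q : Fin d → ℕ) {ρ₀ : FermionOp (halfOpenRect Q)} (v : Site d) (h : ρ₀.IsHermitian) :
    vonNeumannEntropy (rectCopy Q ρ₀ v) = vonNeumannEntropy ρ₀ :=
  vonNeumannEntropy_fermionPartialTrace_equiv _ h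

/-- **Aligned cubes are unions of full blocks**: if `(Q_i+1) ∣ N` for every `i`, every block of the rectangular `Q`-tiling that meets `[0,N)^d`
lies inside it. [cite: BratteliRobinsonII1997, Thm. 6.2.40] -/
theorem rectPartition_block_subset_halfOpenBox (Q : Fin d → ℕ) {N : ℕ} (hN : ∀ i, (Q i + 1) ∣ N) {v : Site d}
    (hv : v ∈ (rectPartition d Q).blockClasses (halfOpenBox d N)) : (rectPartition d Q).block v ⊆ halfOpenBox d N := by
  rw [BlockPartition.blockClasses, Finset.mem_image] at hv
  obtain ⟨x, hx, rfl⟩ := hv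
  intro y hy
  rw [rectPartition_block, mem_shiftSet_superlatVec_halfOpenRect] at hy
  rw [mem_halfOpenBox] at hx ⊢
  intro i
  obtain ⟨M, hM⟩ := hN i
  obtain ⟨hx0, hxN⟩ := hx i
  obtain ⟨hy1, hy2⟩ := hy i
  have hp : (0 : ℤ) < (Q i : ℤ) + 1 := by positivity
  have hMN : (N : ℤ) = ((Q i : ℤ) + 1) * (M : ℤ) := by exact_mod_cast hM
  -- the class coordinate `x_i / (Q_i+1)` lies in `[0, M)`
  have hc0 : 0 ≤ x i / ((Q i : ℤ) + 1) := Int.ediv_nonneg hx0 hp.le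
  have hcM : x i / ((Q i : ℤ) + 1) < M := by
    rw [Int.ediv_lt_iff_lt_mul hp]
    rw [hMN, mul_comm] at hxN
    exact hxN
  have hcM' : x i / ((Q i : ℤ) + 1) + 1 ≤ M := by omega
  have h1 : 0 ≤ x i / ((Q i : ℤ) + 1) * ((Q i : ℤ) + 1) := mul_nonneg hc0 hp.le
  have h2 : (x i / ((Q i : ℤ) + 1) + 1) * ((Q i : ℤ) + 1) ≤ (M : ℤ) * ((Q i : ℤ) + 1) :=
    mul_le_mul_of_nonneg_right hcM' hp.le
  constructor
  · exact le_trans h1 hy1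
  · calc y i < x i / ((Q i : ℤ) + 1) * ((Q i : ℤ) + 1) + ((Q i : ℤ) + 1) := hy2
      _ = (x i / ((Q i : ℤ) + 1) + 1) * ((Q i : ℤ) + 1) := by ring
      _ ≤ (M : ℤ) * ((Q i : ℤ) + 1) := h2
      _ = N := by rw [hMN, mul_comm]

/-- **Counting the blocks of an aligned cube**: `#classes([0,N)^d) · Π_i(Q_i+1) = N^d` when `(Q_i+1) ∣ N`. [cite: BratteliRobinsonII1997, Thm. 6.2.40] -/
theorem card_blockClasses_mul_prod_eq_pow (Q : Fin d → ℕ) {N : ℕ} (hN : ∀ i, (Q i + 1) ∣ N) :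
    ((rectPartition d Q).blockClasses (halfOpenBox d N)).card * ∏ i, (Q i + 1) = N ^ d := by
  have h := (rectPartition d Q).sum_card_blockLoc (halfOpenBox d N)
  rw [card_halfOpenBox] at h
  rw [← h, ← smul_eq_mul, ← Finset.sum_const]
  refine Finset.sum_congr rfl fun v hv => ?_
  rw [(rectPartition d Q).blockLoc_eq_block_of_subset (rectPartition_block_subset_halfOpenBox Q hN hv), rectPartition_block, card_shiftSet,
    card_halfOpenRect]

/-- Faithful copies: the transported block state is faithful if `ρ₀` is. [cite: ArakiMoriya2003, §4.1 Def. 4.5] -/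
theorem posDef_rectCopy (Q : Fin d → ℕ) {ρ₀ : FermionOp (halfOpenRect Q)} (v : Site d) (h : ρ₀.PosDef) : (rectCopy Q ρ₀ v).PosDef :=
  posDef_fermionPartialTrace _ h

/-- `0 < |[0,Q+1)|` (as a real number). [cite: ArakiMoriya2003, §4.1 Def. 4.3] -/
theorem card_halfOpenRect_pos (Q : Fin d → ℕ) : (0 : ℝ) < #(halfOpenRect Q) := by
  rw [card_halfOpenRect]
  exact_mod_cast Finset.prod_pos fun i _ => Nat.succ_pos (Q i)

namespace InfVolFermionState

section Tiling

variable (Q : Fin d → ℕ) (ρ₀ : FermionOp (halfOpenRect Q)) (hev : parityAut ρ₀ = ρ₀) (hpd : ρ₀.PosDef) (htr : ρ₀.trace = 1)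

/-- **Box entropies of the rectangular tiling state on aligned cubes**: `S(⊗ρ₀|_{[0,N)^d}) · Π_i(Q_i+1) = N^d · S(ρ₀)` (`(Q_i+1) ∣ N`, `ρ₀` even and
faithful). [cite: ArakiMoriya2003, Theorem 3.8 and §10] [cite: BratteliRobinsonII1997, Thm. 6.2.40] -/
theorem vonNeumannEntropy_rdm_rectTilingState_mul_prod {N : ℕ} (hN : ∀ i, (Q i + 1) ∣ N) :
    vonNeumannEntropy ((rectTilingState Q ρ₀ hev hpd.posSemidef htr).rdm (halfOpenBox d N)) * ((∏ i, (Q i + 1) : ℕ) : ℝ) =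
      (N : ℝ) ^ d * vonNeumannEntropy ρ₀ := by
  classical
  have h : vonNeumannEntropy ((rectTilingState Q ρ₀ hev hpd.posSemidef htr).rdm (halfOpenBox d N)) =
      ∑ v ∈ (rectPartition d Q).blockClasses (halfOpenBox d N), vonNeumannEntropy (rectCopy Q ρ₀ v) :=
    vonNeumannEntropy_rdm_blockProductState_of_forall_subset (rectPartition d Q) (fun v => rectCopy Q ρ₀ v)
      (fun v => parityAut_rectCopy Q v hev) (fun v => posDef_rectCopy Q v hpd) (fun v => (trace_rectCopy Q ρ₀ v).trans htr)
      (fun v hv => rectPartition_block_subset_halfOpenBox Q hN hv)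
  have hc : (((rectPartition d Q).blockClasses (halfOpenBox d N)).card : ℝ) * ((∏ i, (Q i + 1) : ℕ) : ℝ) = (N : ℝ) ^ d := by
    exact_mod_cast card_blockClasses_mul_prod_eq_pow Q hN
  rw [h, Finset.sum_congr rfl fun v _ => vonNeumannEntropy_rectCopy Q v hpd.1, Finset.sum_const, nsmul_eq_mul, ← hc]
  ring

/-- **The entropy density of every aligned cube is `S(ρ₀)/|[0,Q+1)|`.** [cite: ArakiMoriya2003, Theorem 3.8 and §10] -/
theorem boxEntropyDensity_rectTilingState {N : ℕ} (hN1 : 1 ≤ N) (hN : ∀ i, (Q i + 1) ∣ N) :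
    (rectTilingState Q ρ₀ hev hpd.posSemidef htr).boxEntropyDensity N = vonNeumannEntropy ρ₀ / #(halfOpenRect Q) := by
  have hP : (0 : ℝ) < ((∏ i, (Q i + 1) : ℕ) : ℝ) := by exact_mod_cast Finset.prod_pos fun i _ => Nat.succ_pos (Q i)
  have hN0 : (0 : ℝ) < N := by exact_mod_cast hN1
  have hNd : (0 : ℝ) < (N : ℝ) ^ d := by positivity
  rw [boxEntropyDensity_apply, card_halfOpenRect, div_eq_div_iff hNd.ne' hP.ne', vonNeumannEntropy_rdm_rectTilingState_mul_prod Q ρ₀ hev hpd htr hN,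
    mul_comm]

/-- **THE ENTROPY DENSITY OF THE RECTANGULAR TILING STATE**: `s̄(⊗_v ρ₀) = S(ρ₀)/|[0,Q+1)|` exactly (`d ≥ 1`, `ρ₀` even and faithful).
[cite: BratteliRobinsonII1997, Thm. 6.2.40] [cite: ArakiMoriya2003, Theorem 3.8 and §10] -/
theorem entropyDensitySup_rectTilingState (hd : 0 < d) :
    (rectTilingState Q ρ₀ hev hpd.posSemidef htr).entropyDensitySup = vonNeumannEntropy ρ₀ / #(halfOpenRect Q) := by
  have hL1 : 1 ≤ ∏ i, (Q i + 1) := Finset.prod_pos fun i _ => Nat.succ_pos (Q i)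
  have hLQ : ∀ i, (Q i + 1) ∣ ∏ j, (Q j + 1) := fun i => Finset.dvd_prod_of_mem _ (Finset.mem_univ i)
  have hper := rectTilingState_isPeriodic Q ρ₀ hev hpd.posSemidef htr
  have h1 := hper.tendsto_boxEntropyDensity_mul hd hL1 hLQ
  have h2 : Tendsto (fun k : ℕ => (rectTilingState Q ρ₀ hev hpd.posSemidef htr).boxEntropyDensity (k * ∏ i, (Q i + 1))) atTop
      (𝓝 (vonNeumannEntropy ρ₀ / #(halfOpenRect Q))) := by
    refine tendsto_const_nhds.congr' ?_
    filter_upwards [Filter.eventually_ge_atTop 1] with k hk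
    exact (boxEntropyDensity_rectTilingState Q ρ₀ hev hpd htr (Nat.mul_pos hk hL1) fun i => (hLQ i).mul_left k).symm
  exact tendsto_nhds_unique h1 h2

end Tiling

/-! ### §2. The exact trial value and the floor -/

section Floor

variable (Q : Fin d → ℕ) (ρ₀ : FermionOp (halfOpenRect Q)) (hev : parityAut ρ₀ = ρ₀) {Ψ : FermionInteraction d} {R : ℝ}

/-- **THE EXACT CELL ENERGY DENSITY of the tiling state**: when the terms of `Ψ` straddling the block boundary have zero expectation in `⊗ρ₀`,
`ē_Q(⊗ρ₀) = |[0,Q+1)|⁻¹ · (Re tr(H_{[0,Q+1)} ρ₀) − Re Ψ∅)` (no periodicity of `Ψ` needed). [cite: Ruelle1969, §3.3] [cite: BratteliRobinsonII1997, Thm. 6.2.40] -/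
theorem cellMeanEnergy_rectTilingState_eq (hpsd : ρ₀.PosSemidef) (htr : ρ₀.trace = 1) (hR : Ψ.HasFiniteRange R)
    (hvan : ∀ Y : Finset (Site d), ¬ Y ⊆ halfOpenRect Q → (Y ∩ halfOpenRect Q).Nonempty →
      (rectTilingState Q ρ₀ hev hpsd htr).expect Y (Ψ.Φ Y) = 0) :
    cellMeanEnergy Q Ψ (rectTilingState Q ρ₀ hev hpsd htr) R =
      (#(halfOpenRect Q) : ℝ)⁻¹ * ((Ψ.localHamiltonian (halfOpenRect Q) * ρ₀).trace.re - ((Ψ.Φ ∅) ∅ ∅).re) := by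
  -- `|Cell Q| = |[0,Q+1)|` (also `InfVolFermionState.card_cell_eq_card_halfOpenRect` of `PeriodicRectTrialState`, not imported here)
  have hcard : Fintype.card (Cell Q) = #(halfOpenRect Q) := by
    rw [card_halfOpenRect, Fintype.card_pi]
    simp only [Fintype.card_fin]
  rw [cellMeanEnergy, hcard, ← Complex.re_sum, sum_cell_siteEnergy_rectTilingState_eq Q ρ₀ hev hpsd htr hR hvan,
    expect_empty_eq, Complex.sub_re]

variable (hpd : ρ₀.PosDef) (htr : ρ₀.trace = 1)

/-- **THE EXACT TRIAL VALUE IS A FLOOR**: for `Ψ` Hermitian, even, `q`-periodic of finite range `R` (`d ≥ 1`), an aligned rectangle `[0,Q+1)`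
(`(q_i+1) ∣ (Q_i+1)`), an even faithful density matrix `ρ₀` on it in which the straddling terms of `Ψ` vanish, and every real `β`:
`S(ρ₀) − β Re tr(H_{[0,Q+1)} ρ₀) + β Re Ψ∅ ≤ |[0,Q+1)| · P_q(β,Ψ,R)`. [cite: BratteliRobinsonII1997, Thm. 6.2.40] [cite: Israel1979, Thm. I.2.4] -/
theorem vonNeumannEntropy_sub_mul_le_card_mul_perVarPressure (hd : 0 < d) (hH : Ψ.IsHermitian) (hE : Ψ.IsEven) {q : Fin d → ℕ}
    (hΨ : Ψ.IsPeriodic q) (hR : Ψ.HasFiniteRange R) (hqQ : ∀ i, (q i + 1) ∣ (Q i + 1))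
    (hvan : ∀ Y : Finset (Site d), ¬ Y ⊆ halfOpenRect Q → (Y ∩ halfOpenRect Q).Nonempty →
      (rectTilingState Q ρ₀ hev hpd.posSemidef htr).expect Y (Ψ.Φ Y) = 0) (β : ℝ) :
    vonNeumannEntropy ρ₀ - β * (Ψ.localHamiltonian (halfOpenRect Q) * ρ₀).trace.re + β * ((Ψ.Φ ∅) ∅ ∅).re ≤
      (#(halfOpenRect Q) : ℝ) * Ψ.perVarPressure β q R := by
  have hper : (rectTilingState Q ρ₀ hev hpd.posSemidef htr).IsPeriodic Q := rectTilingState_isPeriodic Q ρ₀ hev hpd.posSemidef htr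
  have hP := Ψ.sub_mul_le_perVarPressure β Q R hper
  rw [Ψ.perVarPressure_eq_of_dvd hd hH hE hΨ hR hqQ β, entropyDensitySup_rectTilingState Q ρ₀ hev hpd htr hd,
    cellMeanEnergy_rectTilingState_eq Q ρ₀ hev hpd.posSemidef htr hR hvan] at hP
  have hc := card_halfOpenRect_pos Q
  have e1 : vonNeumannEntropy ρ₀ / #(halfOpenRect Q) -
      β * ((#(halfOpenRect Q) : ℝ)⁻¹ * ((Ψ.localHamiltonian (halfOpenRect Q) * ρ₀).trace.re - ((Ψ.Φ ∅) ∅ ∅).re)) =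
      (vonNeumannEntropy ρ₀ - β * (Ψ.localHamiltonian (halfOpenRect Q) * ρ₀).trace.re + β * ((Ψ.Φ ∅) ∅ ∅).re) / #(halfOpenRect Q) := by
    field_simp
    ring
  rw [e1, div_le_iff₀' hc] at hP
  exact hP

/-- **THE EXACT CLUSTER-GIBBS FLOOR.** For `Ψ` Hermitian, even, `q`-periodic of finite range `R` (`d ≥ 1`) whose straddling terms vanish in every
block product state over the aligned rectangle `[0,Q+1)` (`(q_i+1) ∣ (Q_i+1)`), and every real `β`:
`log Re Tr e^{−βH_{[0,Q+1)}} + β Re Ψ∅ ≤ |[0,Q+1)| · P_q(β,Ψ,R)` — the open-cluster free energy per site caps the infinite-volume free energy per site,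
with NO collar term. [cite: Israel1979, Lemma II.3.1] [cite: BratteliRobinsonII1997, Thm. 6.2.40] -/
theorem _root_.Literature.MathematicalPhysics.QuantumLattice.FermionInteraction.log_partitionFn_rect_le_card_mul_perVarPressure (hd : 0 < d)
    (hH : Ψ.IsHermitian) (hE : Ψ.IsEven) {q : Fin d → ℕ} (hΨ : Ψ.IsPeriodic q) (hR : Ψ.HasFiniteRange R) (hqQ : ∀ i, (q i + 1) ∣ (Q i + 1))
    (hvan : ∀ (σ : FermionOp (halfOpenRect Q)) (hσe : parityAut σ = σ) (hσp : σ.PosSemidef) (hσt : σ.trace = 1) (Y : Finset (Site d)),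
      ¬ Y ⊆ halfOpenRect Q → (Y ∩ halfOpenRect Q).Nonempty → (rectTilingState Q σ hσe hσp hσt).expect Y (Ψ.Φ Y) = 0) (β : ℝ) :
    Real.log (Matrix.partitionFn β (Ψ.localHamiltonian (halfOpenRect Q))).re + β * ((Ψ.Φ ∅) ∅ ∅).re ≤
      (#(halfOpenRect Q) : ℝ) * Ψ.perVarPressure β q R := by
  haveI : Nonempty (Finset (Orb (PolySite (halfOpenRect Q)))) := ⟨∅⟩
  have hHn := FermionInteraction.localHamiltonian_isHermitian hH (halfOpenRect Q)
  have hZ := Matrix.partitionFn_pos β hHn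
  set ρ : FermionOp (halfOpenRect Q) :=
    (Matrix.partitionFn β (Ψ.localHamiltonian (halfOpenRect Q)))⁻¹ • Matrix.gibbsWeight β (Ψ.localHamiltonian (halfOpenRect Q)) with hρ
  have hρpd : ρ.PosDef := by
    have hZr : 0 < (∑ i, Real.exp (-(β * hHn.eigenvalues i))) := by
      have h := hZ
      rw [hHn.partitionFn_eq_ofReal] at h
      exact_mod_cast h
    rw [hρ, hHn.partitionFn_eq_ofReal, ← Complex.ofReal_inv]
    exact (Matrix.posDef_gibbsWeight β hHn).smul (Complex.zero_lt_real.2 (inv_pos.2 hZr))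
  have hρtr : ρ.trace = 1 := Matrix.trace_gibbsDensity β _ hZ.ne'
  have hρev : parityAut ρ = ρ := by
    rw [hρ, map_smul, parityAut_gibbsWeight (FermionInteraction.parityAut_localHamiltonian hE _)]
  have hG : vonNeumannEntropy ρ - β * (Ψ.localHamiltonian (halfOpenRect Q) * ρ).trace.re =
      Real.log (Matrix.partitionFn β (Ψ.localHamiltonian (halfOpenRect Q))).re := by
    rw [hρ, hHn.vonNeumannEntropy_gibbsDensity β, Matrix.gibbsEntropy_def, Matrix.trace_mul_comm, Matrix.trace_gibbsDensity_mul]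
    ring
  rw [← hG]
  exact vonNeumannEntropy_sub_mul_le_card_mul_perVarPressure Q ρ hρev hρpd hρtr hd hH hE hΨ hR hqQ (hvan ρ hρev hρpd.posSemidef hρtr) β

/-- **Per-site form**: `(log Re Tr e^{−βH_{[0,Q+1)}} + β Re Ψ∅)/|[0,Q+1)| ≤ P_q(β,Ψ,R)`. [cite: Israel1979, Lemma II.3.1] -/
theorem _root_.Literature.MathematicalPhysics.QuantumLattice.FermionInteraction.log_partitionFn_rect_div_le_perVarPressure (hd : 0 < d)
    (hH : Ψ.IsHermitian) (hE : Ψ.IsEven) {q : Fin d → ℕ} (hΨ : Ψ.IsPeriodic q) (hR : Ψ.HasFiniteRange R) (hqQ : ∀ i, (q i + 1) ∣ (Q i + 1))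
    (hvan : ∀ (σ : FermionOp (halfOpenRect Q)) (hσe : parityAut σ = σ) (hσp : σ.PosSemidef) (hσt : σ.trace = 1) (Y : Finset (Site d)),
      ¬ Y ⊆ halfOpenRect Q → (Y ∩ halfOpenRect Q).Nonempty → (rectTilingState Q σ hσe hσp hσt).expect Y (Ψ.Φ Y) = 0) (β : ℝ) :
    (Real.log (Matrix.partitionFn β (Ψ.localHamiltonian (halfOpenRect Q))).re + β * ((Ψ.Φ ∅) ∅ ∅).re) / #(halfOpenRect Q) ≤
      Ψ.perVarPressure β q R := by
  rw [div_le_iff₀' (card_halfOpenRect_pos Q)]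
  exact FermionInteraction.log_partitionFn_rect_le_card_mul_perVarPressure Q hd hH hE hΨ hR hqQ hvan β

/-- **A certified lower bound `ℓ ≤ log Re Tr e^{−βH_{[0,Q+1)}}` is a certified floor `(ℓ + β Re Ψ∅)/|[0,Q+1)| ≤ P_q(β,Ψ,R)`.**
[cite: Israel1979, Lemma II.3.1] -/
theorem _root_.Literature.MathematicalPhysics.QuantumLattice.FermionInteraction.div_le_perVarPressure_of_le_log_partitionFn_rect (hd : 0 < d)
    (hH : Ψ.IsHermitian) (hE : Ψ.IsEven) {q : Fin d → ℕ} (hΨ : Ψ.IsPeriodic q) (hR : Ψ.HasFiniteRange R) (hqQ : ∀ i, (q i + 1) ∣ (Q i + 1))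
    (hvan : ∀ (σ : FermionOp (halfOpenRect Q)) (hσe : parityAut σ = σ) (hσp : σ.PosSemidef) (hσt : σ.trace = 1) (Y : Finset (Site d)),
      ¬ Y ⊆ halfOpenRect Q → (Y ∩ halfOpenRect Q).Nonempty → (rectTilingState Q σ hσe hσp hσt).expect Y (Ψ.Φ Y) = 0) (β : ℝ) {ℓ : ℝ}
    (hℓ : ℓ ≤ Real.log (Matrix.partitionFn β (Ψ.localHamiltonian (halfOpenRect Q))).re) :
    (ℓ + β * ((Ψ.Φ ∅) ∅ ∅).re) / #(halfOpenRect Q) ≤ Ψ.perVarPressure β q R := by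
  have h1 : (ℓ + β * ((Ψ.Φ ∅) ∅ ∅).re) / #(halfOpenRect Q) ≤
      (Real.log (Matrix.partitionFn β (Ψ.localHamiltonian (halfOpenRect Q))).re + β * ((Ψ.Φ ∅) ∅ ∅).re) / #(halfOpenRect Q) :=
    div_le_div_of_nonneg_right (by linarith) (card_halfOpenRect_pos Q).le
  exact h1.trans (FermionInteraction.log_partitionFn_rect_div_le_perVarPressure Q hd hH hE hΨ hR hqQ hvan β)

/-! ### §3. Sub-cluster form: the block Hamiltonian lives on a sub-region -/

/-- **SUB-CLUSTER FORM OF THE FLOOR.** If the block Hamiltonian is the embedding of a Hermitian `H_S` on a sub-region `S ⊆ [0,Q+1)` (the other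
sites carry no term — the dummy sites of a decorated lattice), then
`log Re Tr_S e^{−βH_S} + 2(|[0,Q+1)| − |S|)·log 2 + β Re Ψ∅ ≤ |[0,Q+1)| · P_q(β,Ψ,R)`: the device traces over the physical cluster only.
[cite: BratteliRobinsonII1997, §5.2.2] [cite: Israel1979, Lemma II.3.1] -/
theorem _root_.Literature.MathematicalPhysics.QuantumLattice.FermionInteraction.log_partitionFn_sub_le_card_mul_perVarPressure (hd : 0 < d)
    (hH : Ψ.IsHermitian) (hE : Ψ.IsEven) {q : Fin d → ℕ} (hΨ : Ψ.IsPeriodic q) (hR : Ψ.HasFiniteRange R) (hqQ : ∀ i, (q i + 1) ∣ (Q i + 1))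
    (hvan : ∀ (σ : FermionOp (halfOpenRect Q)) (hσe : parityAut σ = σ) (hσp : σ.PosSemidef) (hσt : σ.trace = 1) (Y : Finset (Site d)),
      ¬ Y ⊆ halfOpenRect Q → (Y ∩ halfOpenRect Q).Nonempty → (rectTilingState Q σ hσe hσp hσt).expect Y (Ψ.Φ Y) = 0)
    {S : Finset (Site d)} (hS : S ⊆ halfOpenRect Q) {HS : FermionOp S} (hHS : HS.IsHermitian)
    (hemb : Ψ.localHamiltonian (halfOpenRect Q) = fermionEmbed (PolySite.incl hS) HS) (β : ℝ) :
    Real.log (Matrix.partitionFn β HS).re + (((#(halfOpenRect Q) - #S) * 2 : ℕ) : ℝ) * Real.log 2 + β * ((Ψ.Φ ∅) ∅ ∅).re ≤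
      (#(halfOpenRect Q) : ℝ) * Ψ.perVarPressure β q R := by
  have h := FermionInteraction.log_partitionFn_rect_le_card_mul_perVarPressure Q hd hH hE hΨ hR hqQ hvan β
  rw [hemb, log_partitionFn_fermionEmbed (PolySite.incl hS) β hHS, card_orb_polySite, card_orb_polySite, ← Nat.sub_mul] at h
  exact h

end Floor

end InfVolFermionState

end Literature.MathematicalPhysics.QuantumLattice

end
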